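import Summits.KontsevichZagierPeriods.KontsevichZagierPeriods.Theses.MarkovTreeOfMoves
import Literature.NumberTheory.Transcendental.KZNoriSymbol
import Literature.AlgebraicGeometry.Motives.ClassicalPeriodDatumKernel

/-!
# Crux `LaurentMoveKernel` (stmt-KontsevichZagierPeriods-4542) — birth skeleton (`Lines/birth.lean`, BC3)

Route `MarkovTreeOfMoves`, rank-4 crux `LaurentMoveKernel` (declared OPEN CORE): for every subgroup
`R ≥ KZ.relations` of formal combinations of integral representations which is CLOSED UNDER THE
PERIOD-SEQUENCE (LAURENT) MOVE — it contains `[R_f(t₀)] − [R_g(t₀)]` for all Laurent polynomials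
`f, g ∈ ℚ[x₁^±, …, xₙ^±]` with equal period sequences `CT(f^k) = CT(g^k)` and every honest rational
`t₀` (torus-period representations on `ℝⁿ` in the tan-half-angle chart) — one has `ker KZ.eval ⊆ R`.
With `R := KZ.relations` and the sibling crux `PeriodSequenceMove` this is the kernel form of
Kontsevich–Zagier's Conjecture 1 (the route's deciding theorem `closes`).

The skeleton cuts the crux along the factorisation `ker eval = Ψ⁻¹(ker ev) ⊆ ker Ψ ⊆ R` of
Kontsevich–Zagier 2001 §4.1 / Huber–Müller-Stach 2017 §13.1 (tree pattern:
`KZ.kernel_subset_relations_of_isFaithful`), run on Viu-Sos normal forms so that the accessibility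
layer speaks about VOLUMES of bounded `ℚ`-semialgebraic bodies and the Laurent move enters exactly
where the crux says it may be used — as an admissible step of the accessibility chains:

* `stub_boundedVolumeNormalForm` (real semialgebraic GEOMETRY inside the rules; provable-class,
  size M; verbatim the normal-form stub of `Cruxes/OffGenusOneSectorKernel/Lines/birth.lean`, so one
  proof serves both lines): every formal combination is congruent modulo `KZ.relations` to a
  difference `[A] − [B]` of two BOUNDED integrand-`1` representations of one common dimension
  [ViuSos2021, Thm. 1.1; CressonViusos2022, §1]. Tools landed: `KZ.exists_sub_add_mem_relations_sign`,
  `KZ.exists_boundedVolume_sub_mem_relations` (sign split, region under the graph, grounding,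
  monomial compression; applied to an integrand-`1` body it is also the dimension-raising slab),
  `KZ.exists_isCompact_of_sub_of_sub_mem_relations` (packing); missing piece: merging finitely many
  bounded bodies of one dimension into one by rule-(2) translations with disjoint images + rule (1a).
* `stub_classicalSymbolInjective` (TRANSCENDENCE, conjecture-grade = Grothendieck–Kontsevich; the
  CONSTRUCTION is part of the claim, nothing is smuggled into an interface; verbatim the sibling's):
  the classical de Rham–Betti period datum over `ℚ` exists as an instance of the tree's hypothesis
  structures (`ClassicalPeriodDatum ℚ` with `KernelData`; Huber–Müller-Stach 2017, Ch. 3, §11),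
  carries Nori symbol data `Ψ` for KZ representations (`KZ.NoriSymbolData`: HMS draft III
  Lemma 11.2.3 / Thm. 11.2.4 plus "moves are motivic", Rem. 12.1.7) and the evaluation of effective
  formal periods on it is injective (`FormalPeriodEvalInjective`, Kontsevich's formal period
  conjecture, HMS 2017 §13.2; ⟺ Grothendieck's period conjecture for Nori motives over `ℚ`). Every
  transcendence consequence of the crux (the three GPC-strength barriers of the catalogue) lives here.
* `stub_motivicVolumesLaurentAccessible` (ACCESSIBILITY MODULO THE LAURENT MOVE, conjecture-grade;
  the stub specific to this route): for every classical period datum with kernel data and every Nori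
  symbol data `Ψ`, two bounded integrand-`1` bodies `A`, `B` of one dimension with the same Nori
  symbol, `Ψ([A] − [B]) = 0` — a MOTIVIC identity of volumes — satisfy `[A] − [B] ∈ R` for every
  subgroup `R ≥ KZ.relations` closed under the period-sequence move (the closure hypothesis is the
  crux's, verbatim): the identity is a finite chain of KZ moves AND Laurent moves `R_f(t₀) ↝ R_g(t₀)`
  (mutations of Landau–Ginzburg mirrors read as steps, AkhtarCoatesGalkinKasprzyk2012 Lemma 1;
  CoatesKasprzykPittonTveiten2021). By (Ψ1) (`ev ∘ Ψ = eval`) this stub is implied by the crux in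
  every model of the interfaces, so it is never stronger than the crux; it is the crux with the
  transcendence theory and the unbounded/signed-integrand bookkeeping removed, and it is strictly
  weaker than plain accessibility `ker Ψ ⊆ KZ.relations` (more admissible steps).

Composition (`LaurentMoveKernel_of`, a real proof): given `R ≥ relations` closed under the Laurent
move and `c` with `eval c = 0`, normalise `c ≡ [A] − [B] (mod relations)`; soundness of the moves
(`KZ.relations_le_ker_eval_holds`) gives `eval ([A] − [B]) = 0`; on the datum of
`stub_classicalSymbolInjective`, (Ψ1) turns this into `ev (Ψ([A] − [B])) = 0` and injectivity into
`Ψ([A] − [B]) = 0`; accessibility gives `[A] − [B] ∈ R`; and `relations ≤ R` climbs back to `c ∈ R`.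
`laurentMoveKernel_of_stubs : LaurentMoveKernel` feeds the three stubs in by name.

Disproof used: none on record (`ledger crux ls stmt-KontsevichZagierPeriods-4542`: no workfiles
before this one, 2026-08-17); negatives index of the summit consulted; degenerate data checked:
`c = 0 ↦ A = B`, `A = B ↦ 0 ∈ R`, empty bodies allowed. Sorries live ONLY in the three `stub_*`
theorems.
-/

noncomputable section

set_option linter.dupNamespace false

open Literature.NumberTheory.Transcendental
open Literature.AlgebraicGeometry.Motives (ClassicalPeriodDatum)
open Summit.KontsevichZagierPeriods.KontsevichZagierPeriods.Theses.MarkovTreeOfMoves (LaurentMoveKernel)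

namespace Summit.KontsevichZagierPeriods.KontsevichZagierPeriods.Cruxes.LaurentMoveKernel.Birth

/-! ### Registered stubs -/

/-- **STUB N — `boundedVolumeNormalForm` (geometry inside the rules; provable-class, size M).**
Every formal `ℤ`-combination of integral representations is congruent, modulo `KZ.relations`, to a
difference `[A] − [B]` of two representations of ONE common dimension with BOUNDED `ℚ`-semialgebraic
domains and integrand `1` on them (two bounded semialgebraic bodies). Plan: `FreeAbelianGroup`
induction; a generator `[r]` is `[A_r] − [B_r]` one dimension up by
`KZ.exists_sub_add_mem_relations_sign` + `KZ.exists_boundedVolume_sub_mem_relations`; dimensions are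
equalised by the same lemma applied to integrand-`1` bodies (slab `× [0,1]`, one dimension at a
time); sums are merged by rule-(2) translations with pairwise disjoint bounded images and rule (1a);
negation swaps `A` and `B`; `c = 0` is `A = B`. Identical to the normal-form stub of
`Cruxes/OffGenusOneSectorKernel/Lines/birth.lean`. [ViuSos2021 Thm. 1.1; CressonViusos2022 §1;
KontsevichZagier2001 §1.2 rules (1), (2), (3)] -/
theorem stub_boundedVolumeNormalForm :
    ∀ c : Literature.NumberTheory.Transcendental.KZ.FormalRep,
      ∃ (m : ℕ) (A B : Literature.NumberTheory.Transcendental.KZ.IntegralRep m),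
        Bornology.IsBounded A.domain ∧ Bornology.IsBounded B.domain ∧
        (∀ z ∈ A.domain, A.integrand z = 1) ∧ (∀ z ∈ B.domain, B.integrand z = 1) ∧
        c - (Literature.NumberTheory.Transcendental.KZ.of A - Literature.NumberTheory.Transcendental.KZ.of B) ∈
          Literature.NumberTheory.Transcendental.KZ.relations := by
  sorry

/-- **STUB T — `classicalSymbolInjective` (transcendence; construction + conjecture, GPC-strength).**
There is a classical period datum over `ℚ` with kernel data (the de Rham–Betti cohomology of pairs,
comparison pairing, connecting morphisms, relative exactness on normal-crossings pairs — HMS 2017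
Ch. 3, §11; draft I §3) carrying Nori symbol data `Ψ` for the Kontsevich–Zagier calculus (every
representation has a symbol `(X, D, ω, γ)` with the right period and dimension, and every instance of
the four moves is a formal-period relation: HMS draft III Lemma 11.2.3, Thm. 11.2.4, Rem. 12.1.7) on
which the evaluation `ev : 𝒫̃⁺ → ℂ` of effective formal periods is INJECTIVE (Kontsevich's formal
period conjecture for the classical datum, HMS 2017 Def. 13.1.1 / §13.2; equivalent to
Grothendieck's period conjecture for Nori motives over `ℚ`). Why it might fail: only if periods of
`ℚ`-varieties satisfy a non-motivic algebraic relation (no candidate is known), or — for the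
construction half — if some KZ move is not a formal-period relation (HMS Rem. 12.1.7, believed).
Identical to the transcendence stub of `Cruxes/OffGenusOneSectorKernel/Lines/birth.lean`.
[Kontsevich1999 §4; KontsevichZagier2001 §4.1; HuberMullerStach2017 §13; Ayoub2014; Chudnovsky1976] -/
theorem stub_classicalSymbolInjective :
    ∃ 𝒞 : Literature.AlgebraicGeometry.Motives.ClassicalPeriodDatum ℚ,
      𝒞.KernelData ∧ Nonempty (𝒞.NoriSymbolData (Rat.castHom ℂ)) ∧
      Literature.NumberTheory.Transcendental.FormalPeriodEvalInjective 𝒞.R 𝒞.B (Rat.castHom ℂ) := by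
  sorry

/-- **STUB A — `motivicVolumesLaurentAccessible` (accessibility of motivic volume identities modulo
the period-sequence move; conjecture-grade, HMS 2017 Rem. 13.1.8 for bounded volumes, weakened by the
extra admissible step of this route).** For every classical period datum over `ℚ` with kernel data and
every Nori symbol data `Ψ` on it: if two bounded integrand-`1` representations `A`, `B` of one
dimension have the same Nori symbol, `Ψ([A] − [B]) = 0` in the effective formal periods (a MOTIVIC
identity between the volumes of two bounded `ℚ`-semialgebraic bodies), then `[A] − [B]` lies in every
subgroup `R ≥ KZ.relations` that contains `[R_f(t₀)] − [R_g(t₀)]` for all Laurent polynomials `f, g`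
over `ℚ` with equal period sequences `CT(f^k) = CT(g^k)` and every honest rational `t₀` (the crux's
closure hypothesis, verbatim) — the identity is a finite chain of KZ moves and Laurent
(mutation / period-sequence) moves. Implied by the crux in every model ((Ψ1): `Ψ y = 0 ⇒ eval y = 0`);
strictly weaker than plain accessibility `ker Ψ ⊆ KZ.relations`. Why it might fail: one motivic
volume identity — an isogeny/correspondence period relation in Hodge level ≥ 2, a Γ-value
(Chowla–Selberg) identity — with no chain of absolutely convergent real moves even with the
toric/Landau–Ginzburg pencil-hopping steps adjoined (Laurent moves are functional identities between
`G`-functions near `t = 0` and never change the Hodge type of what they connect).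
[HuberMullerStach2017 Rem. 13.1.8; KontsevichZagier2001 §1.2, §4.1; AkhtarCoatesGalkinKasprzyk2012
Lemma 1; CoatesKasprzykPittonTveiten2021 Thm. 3.12; CressonViusos2022 §1] -/
theorem stub_motivicVolumesLaurentAccessible :
    ∀ 𝒞 : Literature.AlgebraicGeometry.Motives.ClassicalPeriodDatum ℚ, 𝒞.KernelData →
      ∀ (Ψ : 𝒞.NoriSymbolData (Rat.castHom ℂ)) (m : ℕ)
        (A B : Literature.NumberTheory.Transcendental.KZ.IntegralRep m),
        Bornology.IsBounded A.domain → Bornology.IsBounded B.domain →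
        (∀ z ∈ A.domain, A.integrand z = 1) → (∀ z ∈ B.domain, B.integrand z = 1) →
        Literature.NumberTheory.Transcendental.KZ.noriSymbol Ψ
            (Literature.NumberTheory.Transcendental.KZ.of A - Literature.NumberTheory.Transcendental.KZ.of B) = 0 →
        ∀ (R : AddSubgroup Literature.NumberTheory.Transcendental.KZ.FormalRep),
          Literature.NumberTheory.Transcendental.KZ.relations ≤ R →
          (∀ (n : ℕ) (ev : AddMonoidAlgebra ℚ (Fin n → ℤ) → (Fin n → ℂ) → ℂ) (tc : (Fin n → ℝ) → (Fin n → ℂ)) (J : (Fin n → ℝ) → ℝ), (∀ f x, ev f x = f.coeff.sum (fun v c => (c : ℂ) * ∏ i, x i ^ (v i))) → (∀ u i, tc u i = (((1 - u i ^ 2 : ℝ) : ℂ) + ((2 * u i : ℝ) : ℂ) * Complex.I) / ((1 + u i ^ 2 : ℝ) : ℂ)) → (∀ u, J u = ∏ i, 2 / (1 + u i ^ 2)) → ∀ (f g : AddMonoidAlgebra ℚ (Fin n → ℤ)), (∀ k : ℕ, (f ^ k).coeff 0 = (g ^ k).coeff 0) → ∀ t₀ : ℚ, (∀ x : Fin n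 → ℂ, (∀ i, ‖x i‖ = 1) → ‖(t₀ : ℂ) * ev f x‖ < 1 ∧ ‖(t₀ : ℂ) * ev g x‖ < 1) → ∀ (r r' : Literature.NumberTheory.Transcendental.KZ.IntegralRep n), r.domain = Set.univ → (∀ u, r.integrand u = J u * (1 / (1 - (t₀ : ℂ) * ev f (tc u))).re) → r'.domain = Set.univ → (∀ u, r'.integrand u = J u * (1 / (1 - (t₀ : ℂ) * ev g (tc u))).re) → Literature.NumberTheory.Transcendental.KZ.of r - Literature.NumberTheory.Transcendental.KZ.of r' ∈ R) →
          Literature.NumberTheory.Transcendental.KZ.of A - Literature.NumberTheory.Transcendental.KZ.of B ∈ R := by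
  sorry

/-! ### Composition (no `sorry` below this line) -/

/-- **(Ψ1) + injectivity of `ev`: numerical relations are motivic.** On a classical period datum
carrying Nori symbol data `Ψ` with `ev` injective on the effective formal periods, a formal
combination of integral representations with value `0` has Nori symbol `0`:
`eval y = 0 ⇒ ev (Ψ y) = 0 ⇒ Ψ y = 0` (Kontsevich–Zagier 2001 §4.1; Huber–Müller-Stach 2017 §13.1;
the first half of `KZ.kernel_subset_relations_of_isFaithful`). Sorry-free helper of the composition.
[folklore] -/
theorem noriSymbol_eq_zero_of_eval_eq_zero (𝒞 : ClassicalPeriodDatum ℚ)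
    (Ψ : 𝒞.NoriSymbolData (Rat.castHom ℂ))
    (hinj : FormalPeriodEvalInjective 𝒞.R 𝒞.B (Rat.castHom ℂ)) {y : KZ.FormalRep}
    (hy : KZ.eval y = 0) : KZ.noriSymbol Ψ y = 0 := by
  have h1 : Literature.AlgebraicGeometry.Motives.AlongHom.equiv (Rat.castHom ℂ)
      (formalPeriodEval 𝒞.R (Rat.castHom ℂ) (Ψ.symbol y)) = 0 := by
    rw [Ψ.eval_symbol y, hy]
    simp
  have h2 : formalPeriodEval 𝒞.R (Rat.castHom ℂ) (Ψ.symbol y) = 0 := by simpa using h1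
  rw [KZ.noriSymbol_apply, Submodule.mkQ_apply, Submodule.Quotient.mk_eq_zero]
  exact hinj _ h2

/-- **Composition, hypotheses form (pure logic + soundness of the moves + (Ψ1)).** The three stub
STATEMENTS imply the crux BY NAME: given `R ≥ relations` closed under the Laurent move and `c` with
`eval c = 0`, normalise `c ≡ [A] − [B]`, read `vol A = vol B` off soundness
(`KZ.relations_le_ker_eval_holds`), transport it to `Ψ([A] − [B]) = 0` on the datum of the
transcendence stub ((Ψ1) `KZ.SymbolMap.eval_symbol` and injectivity of `ev`), apply accessibility
modulo the Laurent move to get `[A] − [B] ∈ R`, and climb back along `KZ.relations ≤ R`. [folklore] -/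
theorem LaurentMoveKernel_of :
    (∀ c : Literature.NumberTheory.Transcendental.KZ.FormalRep,
      ∃ (m : ℕ) (A B : Literature.NumberTheory.Transcendental.KZ.IntegralRep m),
        Bornology.IsBounded A.domain ∧ Bornology.IsBounded B.domain ∧
        (∀ z ∈ A.domain, A.integrand z = 1) ∧ (∀ z ∈ B.domain, B.integrand z = 1) ∧
        c - (Literature.NumberTheory.Transcendental.KZ.of A - Literature.NumberTheory.Transcendental.KZ.of B) ∈
          Literature.NumberTheory.Transcendental.KZ.relations) →
    (∃ 𝒞 : Literature.AlgebraicGeometry.Motives.ClassicalPeriodDatum ℚ,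
      𝒞.KernelData ∧ Nonempty (𝒞.NoriSymbolData (Rat.castHom ℂ)) ∧
      Literature.NumberTheory.Transcendental.FormalPeriodEvalInjective 𝒞.R 𝒞.B (Rat.castHom ℂ)) →
    (∀ 𝒞 : Literature.AlgebraicGeometry.Motives.ClassicalPeriodDatum ℚ, 𝒞.KernelData →
      ∀ (Ψ : 𝒞.NoriSymbolData (Rat.castHom ℂ)) (m : ℕ)
        (A B : Literature.NumberTheory.Transcendental.KZ.IntegralRep m),
        Bornology.IsBounded A.domain → Bornology.IsBounded B.domain →
        (∀ z ∈ A.domain, A.integrand z = 1) → (∀ z ∈ B.domain, B.integrand z = 1) →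
        Literature.NumberTheory.Transcendental.KZ.noriSymbol Ψ
            (Literature.NumberTheory.Transcendental.KZ.of A - Literature.NumberTheory.Transcendental.KZ.of B) = 0 →
        ∀ (R : AddSubgroup Literature.NumberTheory.Transcendental.KZ.FormalRep),
          Literature.NumberTheory.Transcendental.KZ.relations ≤ R →
          (∀ (n : ℕ) (ev : AddMonoidAlgebra ℚ (Fin n → ℤ) → (Fin n → ℂ) → ℂ) (tc : (Fin n → ℝ) → (Fin n → ℂ)) (J : (Fin n → ℝ) → ℝ), (∀ f x, ev f x = f.coeff.sum (fun v c => (c : ℂ) * ∏ i, x i ^ (v i))) → (∀ u i, tc u i = (((1 - u i ^ 2 : ℝ) : ℂ) + ((2 * u i : ℝ) : ℂ) * Complex.I) / ((1 + u i ^ 2 : ℝ) : ℂ)) → (∀ u, J u = ∏ i, 2 / (1 + u i ^ 2)) → ∀ (f g : AddMonoidAlgebra ℚ (Fin n → ℤ)), (∀ k : ℕ, (f ^ k).coeff 0 = (g ^ k).coeff 0) → ∀ t₀ : ℚ, (∀ x : Fin n → ℂ, (∀ i, ‖x i‖ = 1) → ‖(t₀ : ℂ) * ev f x‖ < 1 ∧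 ‖(t₀ : ℂ) * ev g x‖ < 1) → ∀ (r r' : Literature.NumberTheory.Transcendental.KZ.IntegralRep n), r.domain = Set.univ → (∀ u, r.integrand u = J u * (1 / (1 - (t₀ : ℂ) * ev f (tc u))).re) → r'.domain = Set.univ → (∀ u, r'.integrand u = J u * (1 / (1 - (t₀ : ℂ) * ev g (tc u))).re) → Literature.NumberTheory.Transcendental.KZ.of r - Literature.NumberTheory.Transcendental.KZ.of r' ∈ R) →
          Literature.NumberTheory.Transcendental.KZ.of A - Literature.NumberTheory.Transcendental.KZ.of B ∈ R) →
    LaurentMoveKernel := by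
  intro hN hT hA R hR hL c hc
  -- Viu-Sos normal form of the whole combination: `c ≡ [A] − [B]` modulo the moves
  obtain ⟨m, A, B, hAb, hBb, hA1, hB1, hcAB⟩ := hN c
  -- the classical datum with its Nori symbol, `ev` injective on its effective formal periods
  obtain ⟨𝒞, h𝒞, ⟨Ψ⟩, hinj⟩ := hT
  -- soundness of the moves: `eval ([A] − [B]) = eval c = 0`, i.e. `vol A = vol B`
  have h0 : KZ.eval (KZ.of A - KZ.of B) = 0 := by
    have h : KZ.eval (c - (KZ.of A - KZ.of B)) = 0 := KZ.relations_le_ker_eval_holds hcAB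
    rw [map_sub, hc, zero_sub, neg_eq_zero] at h
    exact h
  -- (Ψ1) + injectivity of `ev`: the identity `vol A = vol B` is motivic, `Ψ([A] − [B]) = 0`
  have hΨ : KZ.noriSymbol Ψ (KZ.of A - KZ.of B) = 0 :=
    noriSymbol_eq_zero_of_eval_eq_zero 𝒞 Ψ hinj h0
  -- accessibility modulo the Laurent move, inside the given Laurent-closed `R ≥ relations`
  have hAB : KZ.of A - KZ.of B ∈ R := hA 𝒞 h𝒞 Ψ m A B hAb hBb hA1 hB1 hΨ R hR hL
  -- climb back along `relations ≤ R`
  have hsum : c - (KZ.of A - KZ.of B) + (KZ.of A - KZ.of B) ∈ R := add_mem (hR hcAB) hAB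
  rwa [sub_add_cancel] at hsum

/-- **Skeleton theorem (closed form).** The crux `LaurentMoveKernel` BY NAME from the three declared
stubs, via the sorry-free composition `LaurentMoveKernel_of`; `sorry` occurs only inside
`stub_boundedVolumeNormalForm`, `stub_classicalSymbolInjective`, `stub_motivicVolumesLaurentAccessible`
(so a lead closing the three stubs closes the item). -/
theorem laurentMoveKernel_of_stubs : LaurentMoveKernel :=
  LaurentMoveKernel_of stub_boundedVolumeNormalForm stub_classicalSymbolInjective
    stub_motivicVolumesLaurentAccessible

end Summit.KontsevichZagierPeriods.KontsevichZagierPeriods.Cruxes.LaurentMoveKernel.Birth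

end
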